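import Summits.ResolutionOfSingularities.ResolutionOfSingularities.Theorems.WeightedInvariantLocalWeightedDropTrackCDefs
import Literature.AlgebraicGeometry.Resolution.BlowupStalkCharts
import Literature.AlgebraicGeometry.Resolution.QuadraticTransformAlongPrime

/-!
# Track C, the blow-up step AT the centre (i): the point of a chart, and the chart ring over a power series ring

[OURS · L1 W4.3 · chain w43, stub worker 4] Helper for TRACK C of the engine crux `LocalWeightedDrop`
(stmt-ResolutionOfSingularities-8899; skeleton `L/res-L1-w43-stub-4/TrackC_Skeleton.lean`, lemma L2, in-centre case).
NOT a statement of any manuscript.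

* `IsBlowup.exists_point_of_chart` — for a blow-up `π : X' ⟶ X` along `J`, generators `c` of `J_s`, a chart index `j`
  and a prime `𝔴` of the Rees chart ring `B_j = 𝒪_{X,s}[J_s/c_j]` lying over `𝔪_s`: there is a point `x' ∈ X'` over
  `s` and a morphism `q : Spec B_j → X'` through it inducing an isomorphism of local rings at `𝔴` and lying over
  `Spec B_j → Spec 𝒪_{X,s} → X` (the construction of the tree's `IsBlowup.exists_chart_morphism`, which quantifies
  the other way round; blowing ups commute with the flat base change `Spec 𝒪_{X,s} → X` and are unique).
* `exists_chartRing_hom` — **the chart ring over a domain**: for `θ : R → P` to a domain with `θ(cᵢ) ≠ 0` dividing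
  every `θ(c_l)`, `θ(c_l) = θ(cᵢ) d_l`, there is `χ : B_i → P` extending `θ` with `χ(c_l/cᵢ) = d_l` (through the
  tree's `chartToField` into `Frac P`, whose image is generated by `θ(R)` and the `d_l`).
-/

noncomputable section

open CategoryTheory CategoryTheory.Limits AlgebraicGeometry TopologicalSpace IsLocalRing
open Literature.AlgebraicGeometry.Resolution
open Scheme.IdealSheafData

set_option linter.dupNamespace false -- mandated namespace of this single-conjunct summit

namespace Summit.ResolutionOfSingularities.ResolutionOfSingularities.Theorems.TrackC

/-! ## The point of a chart -/

set_option maxHeartbeats 800000 in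
-- the comparison with `Proj` over `Spec 𝒪_{X,s}` elaborates large terms (as in `IsBlowup.exists_chart_morphism`)
/-- **Every prime of a Rees chart over the closed point is the local ring of a point of the blowing up.**
[OURS · folklore] -/
theorem IsBlowup.exists_point_of_chart {X' X : Scheme.{0}} {π : X' ⟶ X} {J : X.IdealSheafData}
    (hπ : IsBlowup π J) (s : X) {n : ℕ} (c : Fin n → X.presheaf.stalk s)
    (hc : Ideal.span (Set.range c) = stalkIdeal J s) (j : Fin n) (w : Spec (.of (chartRing c j)))
    (hw : w.asIdeal.comap (chartBase c j) = maximalIdeal (X.presheaf.stalk s)) :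
    ∃ (x' : X') (q : Spec (.of (chartRing c j)) ⟶ X'), π x' = s ∧ q w = x' ∧ IsIso (q.stalkMap w) ∧
      q ≫ π = Spec.map (CommRingCat.ofHom (chartBase c j)) ≫ X.fromSpecStalk s := by
  classical
  have hcj : ∀ j, c j ∈ Ideal.span (Set.range c) := fun j =>
    Ideal.mem_span_range_self (f := c) (x := j)
  haveI : Flat (X.fromSpecStalk s) := flat_fromSpecStalk X s
  have hP : IsBlowup (pullback.snd π (X.fromSpecStalk s))
      (affineBlowup.idealSheaf (Ideal.span (Set.range c))) := by
    have h := hπ.pullback_snd_of_flat (X.fromSpecStalk s)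
    rwa [comap_fromSpecStalk_eq_affineBlowupIdealSheaf, ← hc] at h
  obtain ⟨e, he, -⟩ := (affineBlowup.isBlowup (Ideal.span (Set.range c))).unique hP
  let q : Spec (.of (chartRing c j)) ⟶ X' :=
    (affineBlowup.chartι (c j) (hcj j) ≫ e.hom) ≫ pullback.fst π (X.fromSpecStalk s)
  have hsq : q ≫ π = Spec.map (CommRingCat.ofHom (chartBase c j)) ≫ X.fromSpecStalk s := by
    rw [Category.assoc, pullback.condition, Category.assoc, reassoc_of% he, ← Category.assoc,
      affineBlowup.chartι_π (c j) (hcj j)]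
  refine ⟨q w, q, ?_, rfl, ?_, hsq⟩
  · -- `π (q w) = s`: `w` lies over the closed point of `Spec 𝒪_{X,s}`
    have h1 : π (q w) = (Spec.map (CommRingCat.ofHom (chartBase c j)) ≫ X.fromSpecStalk s) w := by
      rw [← hsq, Scheme.Hom.comp_apply]
      rfl
    have h2 : Spec.map (CommRingCat.ofHom (chartBase c j)) w = closedPoint (X.presheaf.stalk s) := by
      apply PrimeSpectrum.ext
      change Ideal.comap _ _ = maximalIdeal _
      exact hw
    rw [h1, Scheme.Hom.comp_apply, h2]
    exact Scheme.fromSpecStalk_closedPoint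
  · have h1 := isIso_stalkMap_pullback_fst_fromSpecStalk π s
      ((affineBlowup.chartι (c j) (hcj j) ≫ e.hom) w)
    haveI : IsOpenImmersion (affineBlowup.chartι (c j) (hcj j) ≫ e.hom) := inferInstance
    have h2 : IsIso ((affineBlowup.chartι (c j) (hcj j) ≫ e.hom).stalkMap w) := inferInstance
    change IsIso (((affineBlowup.chartι (c j) (hcj j) ≫ e.hom) ≫ pullback.fst π (X.fromSpecStalk s)).stalkMap w)
    rw [Scheme.Hom.stalkMap_comp]
    exact @IsIso.comp_isIso _ _ _ _ _ _ _ h1 h2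

/-! ## The chart ring over a domain -/

/-- **A ring homomorphism from the Rees chart ring to a domain** in which `θ(cᵢ) ≠ 0` divides all `θ(c_l)`.
[OURS · folklore] -/
theorem exists_chartRing_hom {R : Type} [CommRing R] {n : ℕ} (c : Fin n → R) (i : Fin n)
    {P : Type} [CommRing P] [IsDomain P] (θ : R →+* P) (hθ : θ (c i) ≠ 0) (d : Fin n → P)
    (hd : ∀ l, θ (c l) = θ (c i) * d l) :
    ∃ χ : chartRing c i →+* P, (∀ r, χ (chartBase c i r) = θ r) ∧ ∀ l, χ (chartGen c i l) = d l := by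
  let ι : P →+* FractionRing P := algebraMap P (FractionRing P)
  have hι : Function.Injective ι := IsFractionRing.injective P (FractionRing P)
  have hθ' : (ι.comp θ) (c i) ≠ 0 := by
    rw [RingHom.comp_apply]
    exact fun h => hθ (hι (by rw [h, map_zero]))
  let χ₀ := chartToField c i (ι.comp θ) hθ'
  have hgen : ∀ l, χ₀ (chartGen c i l) = ι (d l) := by
    intro l
    change chartToField c i (ι.comp θ) hθ' _ = _
    rw [chartToField_chartGen, RingHom.comp_apply, RingHom.comp_apply, hd l, map_mul,
      mul_div_cancel_left₀ _ (by rwa [RingHom.comp_apply] at hθ')]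
  -- the image of `χ₀` lies in `P`
  have hmem : ∀ b, χ₀ b ∈ ι.range := by
    intro b
    have h1 := chartToField_mem_closure c i (ι.comp θ) hθ' b
    refine (Subring.closure_le.mpr ?_) h1
    rintro _ (⟨r, rfl⟩ | ⟨l, rfl⟩)
    · exact ⟨θ r, rfl⟩
    · refine ⟨d l, ?_⟩
      change ι (d l) = ι (θ (c l)) / ι (θ (c i))
      rw [hd l, map_mul, mul_div_cancel_left₀ _ (by rwa [RingHom.comp_apply] at hθ')]
  let ε := RingEquiv.ofLeftInverse (Function.leftInverse_invFun hι) (f := ι)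
  let χ : chartRing c i →+* P := ε.symm.toRingHom.comp (χ₀.codRestrict ι.range hmem)
  have hχ : ∀ b, ι (χ b) = χ₀ b := fun b => by
    change ι (ε.symm ⟨χ₀ b, hmem b⟩) = _
    obtain ⟨p, hp⟩ := hmem b
    have : (⟨χ₀ b, hmem b⟩ : ι.range) = ε p := Subtype.ext (by rw [RingEquiv.ofLeftInverse_apply]; exact hp.symm)
    rw [this, RingEquiv.symm_apply_apply, hp]
  refine ⟨χ, fun r => hι ?_, fun l => hι ?_⟩
  · rw [hχ]
    exact chartToField_reesChartBase c i (ι.comp θ) hθ' r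
  · rw [hχ, hgen]

end Summit.ResolutionOfSingularities.ResolutionOfSingularities.Theorems.TrackC

end
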